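import Summits.Schanuel.Schanuel.Theorems.SoloInformedClusterWeights

/-!
# The cluster budget: average number of violated progressions at full depth

Soloist file (informed mode, seat `solo-Schanuel-informed`, s184).  Third file of the seat's
THEOREM AE₃♯-1 (work note `work/s184/CLUSTER-note.md`); it combines the weighted AE₃ core and
the per-triple depth of `SoloInformedClusterWeights` into the bound consumed by the weighted
selection `soloSel_exists_selection` (`SoloInformedClusterSelection`).

Setting.  `F : ℤ[X]`, `F ≠ 0`, roots `ρ : Fin D → ℂ` with multiplicity; points `x ξ`
(`x ∈ S ⊆ ℕ`); clusters `Cl x` of root indices within `r ≤ ‖ξ‖/2` of `x ξ` (so clusters of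
distinct points are disjoint); weights `u x i` with `‖ρ_i − x ξ‖ ≤ e^{−u x i}` and
`u x i ≥ θ ≥ 2 log 4` on `Cl x`; a common lower bound `0 < U' ≤ ∑_{Cl x} u x ·`.  Over the
non-trivial 3-term progressions `(x, m, z)` of `S` (`x + z = 2m`, `x ≠ z`) and the triples
`(i, j, k) ∈ Cl x × Cl m × Cl z` with `ρ_i + ρ_k − 2 ρ_j ≠ 0` (probabilities
`p = u / ∑_{Cl} u`):

* `soloCB_cluster_budget` — `U' · ∑_{(x,m,z)} ∑_{(i,j,k)} p_x(i) p_m(j) p_z(k)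
  ≤ 2 · (3 D² log M(F) + D³ log 4)`.

Proof: `p_x(i) p_m(j) p_z(k) ≤ min(u_i,u_j,u_k)/U'` (`soloCB_prod_le_min_div`);
`min(u) ≤ log(1/‖ρ_i + ρ_k − 2ρ_j‖) + log 4 ≤ log(1/‖·‖) + min(u)/2` (`soloCW_min_le_log`,
`θ ≥ 2 log 4`); the map `((x,m,z),(i,j,k)) ↦ (i,j,k)` is injective (disjoint clusters,
`soloCB_point_eq`), so the weighted core `soloCW_sum_log_le` bounds the total by the AE₃ budget.
Pieces (prefix `soloCB_`): `soloCB_point_eq`, `soloCB_div_sum_le_one`, `soloCB_div_sum_le_div`,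
`soloCB_prod_le_min_div`.

What this is NOT.  Bookkeeping for the seat's toy node `RoyAdditiveDirichletExponent`
([cite: Roy2010, Thm 1.1]); nothing here bears on `Literature.Periods.SchanuelConjecture` (the
seat's verdict, no path, is unchanged); no novelty claimed.  Tree files and Mathlib only; no
definitions; no literature hypothesis; axioms the standard three.
-/

namespace Summit.Schanuel.Schanuel.Theorems

open Finset Polynomial

section Pieces

variable {D : ℕ}

/-- A root index within `‖ξ‖/2` of two points `x ξ`, `x' ξ` (`x, x'` naturals) forces
`x = x'`. -/
theorem soloCB_point_eq (ρ : Fin D → ℂ) (ξ : ℂ) {x x' : ℕ} {i : Fin D}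
    (hi : ‖ρ i - x * ξ‖ < ‖ξ‖ / 2) (hi' : ‖ρ i - x' * ξ‖ < ‖ξ‖ / 2) : x = x' := by
  by_contra hne
  have hdis := soloSS_filter_disjoint ρ ξ 0 hne
  rw [Finset.disjoint_left] at hdis
  have h1 : i ∈ univ.filter (fun i => ‖ρ i - ((x : ℂ) * ξ + 0)‖ < ‖ξ‖ / 2) := by
    simp [add_zero, hi]
  have h2 : i ∈ univ.filter (fun i => ‖ρ i - ((x' : ℂ) * ξ + 0)‖ < ‖ξ‖ / 2) := by
    simp [add_zero, hi']
  exact hdis h1 h2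

/-- A probability is at most one. -/
theorem soloCB_div_sum_le_one {ι : Type*} (C : Finset ι) (u : ι → ℝ)
    (hpos : ∀ i ∈ C, 0 < u i) {i : ι} (hi : i ∈ C) : u i / ∑ j ∈ C, u j ≤ 1 := by
  have hsum : u i ≤ ∑ j ∈ C, u j := Finset.single_le_sum (fun j hj => (hpos j hj).le) hi
  have hS : 0 < ∑ j ∈ C, u j := Finset.sum_pos hpos ⟨i, hi⟩
  rwa [div_le_one hS]

/-- A probability `u i / ∑_C u` is at most `u i / U'` for a lower bound `0 < U' ≤ ∑_C u`. -/
theorem soloCB_div_sum_le_div {ι : Type*} (C : Finset ι) (u : ι → ℝ)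
    (hpos : ∀ i ∈ C, 0 < u i) {U' : ℝ} (hU'0 : 0 < U') (hU' : U' ≤ ∑ j ∈ C, u j) {i : ι}
    (hi : i ∈ C) : u i / ∑ j ∈ C, u j ≤ u i / U' :=
  div_le_div_of_nonneg_left (hpos i hi).le hU'0 hU'

/-- Three probabilities, each at most `1` and at most `weight / U'`, have product at most
`min(weights) / U'`. -/
theorem soloCB_prod_le_min_div {p₁ p₂ p₃ a b d U' : ℝ} (hU' : 0 ≤ U') (h0₁ : 0 ≤ p₁)
    (h0₂ : 0 ≤ p₂) (h0₃ : 0 ≤ p₃) (h1₁ : p₁ ≤ 1) (h1₂ : p₂ ≤ 1) (h1₃ : p₃ ≤ 1)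
    (ha : p₁ ≤ a / U') (hb : p₂ ≤ b / U') (hd : p₃ ≤ d / U') :
    p₁ * p₂ * p₃ ≤ min a (min b d) / U' := by
  have hA : p₁ * p₂ * p₃ ≤ p₁ := by
    rw [mul_assoc]
    exact mul_le_of_le_one_right h0₁ (mul_le_one₀ h1₂ h0₃ h1₃)
  have hB : p₁ * p₂ * p₃ ≤ p₂ := by
    rw [mul_comm p₁ p₂, mul_assoc]
    exact mul_le_of_le_one_right h0₂ (mul_le_one₀ h1₁ h0₃ h1₃)
  have hC : p₁ * p₂ * p₃ ≤ p₃ := by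
    rw [mul_comm]
    exact mul_le_of_le_one_right h0₃ (mul_le_one₀ h1₁ h0₂ h1₂)
  rw [← min_div_div_right hU', ← min_div_div_right hU']
  exact le_min (hA.trans ha) (le_min (hB.trans hb) (hC.trans hd))

end Pieces

section Budget

variable {D : ℕ}

/-- **The cluster budget.**  See the file header: with clusters of radius `r ≤ ‖ξ‖/2`,
weights `u ≥ θ ≥ 2 log 4` certifying `‖ρ_i − xξ‖ ≤ e^{−u}`, and `0 < U' ≤ ∑_{Cl x} u`
(`x ∈ S`), the `U'`-multiple of the average number of violated non-trivial progressions is at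
most twice the AE₃ budget `3 D² log M(F) + D³ log 4`. -/
theorem soloCB_cluster_budget (F : ℤ[X]) (hF : F ≠ 0) (hD : F.natDegree = D)
    (ρ : Fin D → ℂ) (hρ : univ.val.map ρ = (F.map (Int.castRingHom ℂ)).roots) (ξ : ℂ)
    {r : ℝ} (hr : r ≤ ‖ξ‖ / 2) (S : Finset ℕ) (Cl : ℕ → Finset (Fin D))
    (hCl : ∀ x ∈ S, ∀ i ∈ Cl x, ‖ρ i - x * ξ‖ < r) (u : ℕ → Fin D → ℝ)
    (hu : ∀ x ∈ S, ∀ i ∈ Cl x, ‖ρ i - x * ξ‖ ≤ Real.exp (-u x i)) {θ : ℝ}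
    (hθ4 : 2 * Real.log 4 ≤ θ) (hθ : ∀ x ∈ S, ∀ i ∈ Cl x, θ ≤ u x i) {U' : ℝ}
    (hU'0 : 0 < U') (hU' : ∀ x ∈ S, U' ≤ ∑ i ∈ Cl x, u x i) :
    U' * ∑ c ∈ (S ×ˢ (S ×ˢ S)).filter (fun c => c.1 + c.2.2 = 2 * c.2.1 ∧ c.1 ≠ c.2.2),
        ∑ q ∈ (Cl c.1 ×ˢ (Cl c.2.1 ×ˢ Cl c.2.2)).filter
          (· ∈ univ.filter (fun q : Fin D × Fin D × Fin D => ρ q.1 + ρ q.2.2 - 2 * ρ q.2.1 ≠ 0)),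
          u c.1 q.1 / (∑ i ∈ Cl c.1, u c.1 i) * (u c.2.1 q.2.1 / ∑ i ∈ Cl c.2.1, u c.2.1 i)
            * (u c.2.2 q.2.2 / ∑ i ∈ Cl c.2.2, u c.2.2 i) ≤
      2 * (((3 * D ^ 2 : ℕ) : ℝ) * Real.log (F.map (Int.castRingHom ℂ)).mahlerMeasure
        + ((D ^ 3 : ℕ) : ℝ) * Real.log 4) := by
  classical
  set A : Finset (ℕ × ℕ × ℕ) := (S ×ˢ (S ×ˢ S)).filter
    (fun c => c.1 + c.2.2 = 2 * c.2.1 ∧ c.1 ≠ c.2.2) with hA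
  set Bad : Finset (Fin D × Fin D × Fin D) :=
    univ.filter (fun q : Fin D × Fin D × Fin D => ρ q.1 + ρ q.2.2 - 2 * ρ q.2.1 ≠ 0) with hBad
  set L : Fin D × Fin D × Fin D → ℂ := fun q => ρ q.1 + ρ q.2.2 - 2 * ρ q.2.1 with hL
  set Fc : ℕ × ℕ × ℕ → Finset (Fin D × Fin D × Fin D) :=
    fun c => (Cl c.1 ×ˢ (Cl c.2.1 ×ˢ Cl c.2.2)).filter (· ∈ Bad) with hFc
  have hlog4 : 0 < Real.log 4 := Real.log_pos (by norm_num)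
  have hupos : ∀ x ∈ S, ∀ i ∈ Cl x, 0 < u x i :=
    fun x hx i hi => by linarith [hθ x hx i hi]
  have hAmem : ∀ c ∈ A, (c.1 ∈ S ∧ c.2.1 ∈ S ∧ c.2.2 ∈ S) ∧
      ((c.1 : ℂ) * ξ + (c.2.2 : ℂ) * ξ = 2 * ((c.2.1 : ℂ) * ξ)) := by
    intro c hc
    rw [hA, Finset.mem_filter, Finset.mem_product, Finset.mem_product] at hc
    refine ⟨hc.1, ?_⟩
    have h : (c.1 : ℂ) + c.2.2 = 2 * c.2.1 := by exact_mod_cast hc.2.1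
    rw [← add_mul, h, mul_assoc]
  have hFmem : ∀ c q, q ∈ Fc c → (q.1 ∈ Cl c.1 ∧ q.2.1 ∈ Cl c.2.1 ∧ q.2.2 ∈ Cl c.2.2) ∧
      L q ≠ 0 := by
    intro c q hq
    rw [hFc, Finset.mem_filter, Finset.mem_product, Finset.mem_product, hBad,
      Finset.mem_filter] at hq
    exact ⟨hq.1, hq.2.2⟩
  -- Step 1: term by term, `U' · p p p ≤ min(u) ≤ 2 log(1/‖L q‖)`
  have hterm : ∀ c ∈ A, ∀ q ∈ Fc c,
      U' * (u c.1 q.1 / (∑ i ∈ Cl c.1, u c.1 i) * (u c.2.1 q.2.1 / ∑ i ∈ Cl c.2.1, u c.2.1 i)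
        * (u c.2.2 q.2.2 / ∑ i ∈ Cl c.2.2, u c.2.2 i)) ≤ 2 * Real.log (1 / ‖L q‖) := by
    intro c hc q hq
    obtain ⟨⟨hx, hm, hz⟩, hxmz⟩ := hAmem c hc
    obtain ⟨⟨hi, hj, hk⟩, hLq⟩ := hFmem c q hq
    have hppp := soloCB_prod_le_min_div hU'0.le
      (div_nonneg (hupos _ hx _ hi).le (Finset.sum_nonneg fun i h => (hupos _ hx i h).le))
      (div_nonneg (hupos _ hm _ hj).le (Finset.sum_nonneg fun i h => (hupos _ hm i h).le))
      (div_nonneg (hupos _ hz _ hk).le (Finset.sum_nonneg fun i h => (hupos _ hz i h).le))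
      (soloCB_div_sum_le_one _ _ (hupos _ hx) hi) (soloCB_div_sum_le_one _ _ (hupos _ hm) hj)
      (soloCB_div_sum_le_one _ _ (hupos _ hz) hk)
      (soloCB_div_sum_le_div _ _ (hupos _ hx) hU'0 (hU' _ hx) hi)
      (soloCB_div_sum_le_div _ _ (hupos _ hm) hU'0 (hU' _ hm) hj)
      (soloCB_div_sum_le_div _ _ (hupos _ hz) hU'0 (hU' _ hz) hk)
    have hmin := soloCW_min_le_log (hu _ hx _ hi) (hu _ hm _ hj) (hu _ hz _ hk) hxmz hLq
    have hθmin : θ ≤ min (u c.1 q.1) (min (u c.2.1 q.2.1) (u c.2.2 q.2.2)) :=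
      le_min (hθ _ hx _ hi) (le_min (hθ _ hm _ hj) (hθ _ hz _ hk))
    calc U' * (u c.1 q.1 / (∑ i ∈ Cl c.1, u c.1 i) * (u c.2.1 q.2.1 / ∑ i ∈ Cl c.2.1, u c.2.1 i)
          * (u c.2.2 q.2.2 / ∑ i ∈ Cl c.2.2, u c.2.2 i))
        ≤ U' * (min (u c.1 q.1) (min (u c.2.1 q.2.1) (u c.2.2 q.2.2)) / U') :=
          mul_le_mul_of_nonneg_left hppp hU'0.le
      _ = min (u c.1 q.1) (min (u c.2.1 q.2.1) (u c.2.2 q.2.2)) := by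
          field_simp
      _ ≤ 2 * Real.log (1 / ‖L q‖) := by linarith
  -- Step 2: the sets `Fc c`, `c ∈ A`, are pairwise disjoint (disjoint clusters)
  have hdisj : (A : Set (ℕ × ℕ × ℕ)).PairwiseDisjoint Fc := by
    intro c hc c' hc' hne
    rw [Function.onFun, Finset.disjoint_left]
    intro q hq hq'
    obtain ⟨⟨hx, hm, hz⟩, -⟩ := hAmem c hc
    obtain ⟨⟨hx', hm', hz'⟩, -⟩ := hAmem c' hc'
    obtain ⟨⟨hi, hj, hk⟩, -⟩ := hFmem c q hq
    obtain ⟨⟨hi', hj', hk'⟩, -⟩ := hFmem c' q hq'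
    have e1 : c.1 = c'.1 := soloCB_point_eq ρ ξ ((hCl _ hx _ hi).trans_le hr)
      ((hCl _ hx' _ hi').trans_le hr)
    have e2 : c.2.1 = c'.2.1 := soloCB_point_eq ρ ξ ((hCl _ hm _ hj).trans_le hr)
      ((hCl _ hm' _ hj').trans_le hr)
    have e3 : c.2.2 = c'.2.2 := soloCB_point_eq ρ ξ ((hCl _ hz _ hk).trans_le hr)
      ((hCl _ hz' _ hk').trans_le hr)
    exact hne (Prod.ext e1 (Prod.ext e2 e3))
  -- Step 3: the weighted core over `T = ⋃_c Fc c`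
  have hT : ∀ q ∈ A.biUnion Fc, L q ≠ 0 := by
    intro q hq
    obtain ⟨c, _, hqc⟩ := Finset.mem_biUnion.mp hq
    exact (hFmem c q hqc).2
  have hcore := soloCW_sum_log_le F hF hD ρ hρ L (fun _ => rfl) (A.biUnion Fc) hT
  calc U' * ∑ c ∈ A, ∑ q ∈ Fc c,
          u c.1 q.1 / (∑ i ∈ Cl c.1, u c.1 i) * (u c.2.1 q.2.1 / ∑ i ∈ Cl c.2.1, u c.2.1 i)
            * (u c.2.2 q.2.2 / ∑ i ∈ Cl c.2.2, u c.2.2 i)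
      = ∑ c ∈ A, ∑ q ∈ Fc c, U' *
          (u c.1 q.1 / (∑ i ∈ Cl c.1, u c.1 i) * (u c.2.1 q.2.1 / ∑ i ∈ Cl c.2.1, u c.2.1 i)
            * (u c.2.2 q.2.2 / ∑ i ∈ Cl c.2.2, u c.2.2 i)) := by
        rw [Finset.mul_sum]
        exact Finset.sum_congr rfl (fun c _ => Finset.mul_sum _ _ _)
    _ ≤ ∑ c ∈ A, ∑ q ∈ Fc c, 2 * Real.log (1 / ‖L q‖) :=
        Finset.sum_le_sum (fun c hc => Finset.sum_le_sum (fun q hq => hterm c hc q hq))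
    _ = 2 * ∑ q ∈ A.biUnion Fc, Real.log (1 / ‖L q‖) := by
        rw [Finset.sum_biUnion hdisj, Finset.mul_sum]
        exact Finset.sum_congr rfl (fun c _ => (Finset.mul_sum _ _ _).symm)
    _ ≤ _ := mul_le_mul_of_nonneg_left hcore (by norm_num)

end Budget

end Summit.Schanuel.Schanuel.Theorems
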